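import Mathlib
import Literature.Algebra.Polynomial.PolyaPositivstellensatz
import HarnessLib

/-!
# The Pólya LP bounds for a form on the simplex converge at rate `O(1/r)`
# (de Klerk–Laurent–Parrilo 2006, §2.1: Theorem 2.1 and Theorem 1.1)

Topic `Literature/Algebra/Polynomial`, namespace `Literature.Algebra.Polynomial.PolyaSimplexRate`.
Builds on `PolyaPositivstellensatz.lean` (the coefficient formula
`prod_factorial_mul_coeff_sum_X_pow_mul` behind Pólya's theorem and the soundness lemma
`eval_nonneg_of_coeff_nonneg`; the Powers–Reznick bound `polya_powersReznick` is the two-sided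
companion of Theorem 1.1 below).

## Source, read on the page

E. de Klerk, M. Laurent, P. A. Parrilo, *A PTAS for the minimization of polynomials of fixed degree
over the simplex*, Theoret. Comput. Sci. 361 (2006) 210–225 [held text
`paper:doi-10-1016-j-tcs-2006-05-011`, pp. 2–7].  Let `p = Σ_{|α|=d} p_α x^α` be a form of degree
`d` in `n ≥ 1` variables, `Δ = {x ≥ 0, Σ xᵢ = 1}` the standard simplex, `p_min = min_Δ p`.

* (1.8) `p^{(0)}_max := max_α p_α α!/d!` (`α! = α₁!⋯αₙ!`); §1.3, display after (1.9): «For any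
  integer `r ≥ 0`, define the parameter `p^{(r)}_min := max λ s.t. the polynomial
  `(Σᵢ xᵢ)^r (p(x) − λ (Σᵢ xᵢ)^d)` has nonnegative coefficients»; «`p^{(r)}_min ≤ p^{(r+1)}_min ≤
  p_min`»; (1.10) «`p^{(0)}_min = min_α p_α α!/d!`»; (1.12)
  `w_r(d) := (r+d)!/(r!(r+d)^d) = Π_{i=1}^{d−1} (1 − i/(r+d))`; (1.13) `1 − C(d,2)/(r+d) ≤ w_r(d) ≤ 1`.
* **Theorem 1.1.** «Let `p` be a form of degree `d` which is positive on the simplex, i.e.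
  `p_min > 0`. Then the polynomial `(Σᵢ xᵢ)^r p(x)` has nonnegative coefficients for all `r`
  satisfying `r ≥ C(d,2) p^{(0)}_max / p_min − d`.» («Powers and Reznick proved that this holds for
  any `r ≥ C(d,2) L_p/p_min − d`. We observe here that this holds for any `r` satisfying the weaker
  condition (1.9) (with `L_p` replaced by `p^{(0)}_max`)».)
* §2.1, display before (2.3): for `|β| = r + d` the coefficient `A_β` of `x^β` in `(Σ xᵢ)^r p` is
  `A_β = Σ_{α ≤ β} p_α r!/(β − α)!`, whence (2.3)
  `p^{(r)}_min = min_{β ∈ I(n, r+d)} (1/w_r(d)) Σ_α p_α Πᵢ (βᵢ/(r+d))^{αᵢ}_{1/(r+d)}` (falling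
  powers with step `t = 1/(r+d)`), a minimum over the grid `Δ(r+d) = {β/(r+d)}`; (2.4)–(2.5)
  `π(x) := p(x) − Σ_α p_α Π (xᵢ)^{αᵢ}_t`, (2.7) `p^{(r)}_min ≥ (1/w_r(d))(p_min − π_max)`,
  (2.13) `π_max ≤ p^{(0)}_max (1 − w_r(d))` («as `x^α ≥ Π (xᵢ)^{αᵢ}_t` and `p_α ≤ p^{(0)}_max d!/α!`»
  and the Vandermonde–Chu identity (2.2)).
* **Theorem 2.1.** «Let `p` be a form of degree `d` and `r ≥ 0` an integer. Then
  `p_min − p^{(r)}_min ≤ (p^{(0)}_max − p_min)(1/w_r(d) − 1)` (2.11),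
  `p_{Δ(r+d)} − p_min ≤ (p^{(0)}_max − p_min)(1 − w_r(d))` (2.12).»
  (`p_{Δ(k)} = min` of `p` over the rational grid points of `Δ` with denominator `k`, (1.3).)

## What is formalised (all proved; no named facts, no `sorry`)

Over any linearly ordered field `𝕜` (so that rational certificates are covered), for a finite
index type `ι` of variables:

* §1 `polyaWeight 𝕜 r d = w_r(d)` with (1.12) (`polyaWeight_eq_prod`) and (1.13)
  (`one_sub_choose_div_le_polyaWeight`, `polyaWeight_le_one`, `polyaWeight_pos`).
* §2 the level-`r` Pólya LP as a predicate `PolyaFeasible r p d λ` («`(Σxᵢ)^r (p − λ(Σxᵢ)^d)` has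
  nonnegative coefficients», so that `p^{(r)}_min = max {λ | PolyaFeasible r p d λ}`), with weak
  duality `PolyaFeasible.le_eval` (`λ ≤ p` on `Δ`, i.e. `p^{(r)}_min ≤ p_min`), monotonicity in `r`
  (`PolyaFeasible.succ`/`.mono`, i.e. `p^{(r)}_min ≤ p^{(r+1)}_min`) and in `λ` (`.of_le`), the
  grid criterion (2.3) (`polyaFeasible_iff`: feasibility ⟺ `λ (r+d)!/r! ≤ D_β(p)` for all
  `|β| = r+d`, `D_β(p) = Σ_α p_α Πᵢ βᵢ(βᵢ−1)⋯(βᵢ−αᵢ+1)` = `fallingEval β p`) and (1.10)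
  (`polyaFeasible_zero_iff`: at level `0`, feasibility ⟺ `λ d!/α! ≤ p_α` for all `|α| = d`).
* §3 the estimate (2.13) in the form `D_β(p) ≥ (r+d)^d p(β/(r+d)) − U((r+d)^d − (r+d)!/r!)`
  whenever `p_α ≤ U d!/α!` for all `α` (`fallingEval_ge`), and from it:
  ★ **Theorem 2.1 (2.11)** in certificate form (`polyaFeasible_rate`,
  `exists_polyaFeasible_sub_eq`): if `p_α α!/d! ≤ U` for all `α` and `λ ≤ p` on `Δ`, then
  `μ_r := λ/w_r(d) − U(1/w_r(d) − 1)` IS feasible at level `r`, and `λ − μ_r = (U − λ)(1/w_r(d) − 1)`;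
  with (1.13) the explicit `O(1/(r+d))` certificate `λ − (U − λ)·C(d,2)/(r + d − C(d,2))`
  (`polyaFeasible_rate_explicit`; `λ ≤ U` automatically, `le_of_coeff_le_of_le_eval`);
  ★ **Theorem 2.1 (2.12)** (`exists_gridPoint_eval_le`): some grid point `x_β ∈ Δ(r+d)` has
  `p(x_β) ≤ w_r(d) p(x) + U (1 − w_r(d))` for every `x ∈ Δ`;
  ★ **Theorem 1.1** (`coeff_sum_X_pow_mul_nonneg_of_le`): if moreover `λ > 0` and
  `U·C(d,2) ≤ λ (r + d)`, then `(Σ xᵢ)^r p` has nonnegative coefficients — and the strict companion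
  (`coeff_sum_X_pow_mul_pos_of_lt`: `U·C(d,2) < λ(r+d)` ⇒ all degree-`(r+d)` coefficients `> 0`),
  i.e. the Powers–Reznick bound with the one-sided constant `p^{(0)}_max` in place of `L_p`.

* §4 over `ℝ`, in the printed form: `simplexMin p = p_min` (attained, `exists_eval_eq_simplexMin`),
  `polyaBound r p d = p^{(r)}_min` (a maximum, attained: `isGreatest_polyaBound`,
  `polyaFeasible_iff_le_polyaBound`), `p^{(r)}_min ≤ p^{(r+1)}_min ≤ p_min` (`polyaBound_le_succ`,
  `polyaBound_le_simplexMin`), ★ (2.11) `simplexMin_sub_polyaBound_le`, ★ (2.12)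
  `exists_gridPoint_sub_simplexMin_le`, ★ Theorem 1.1 `coeff_sum_X_pow_mul_nonneg` — all with any
  `U ≥ p^{(0)}_max` in place of `p^{(0)}_max` (the hypothesis `∀ α, p_α ≤ U · d!/α!`).

## What is NOT formalised

Theorem 1.3 / Theorem 2.2 (the estimate `p^{(0)}_max − p^{(0)}_min ≤ C(2d−1, d) d^d (p_max − p_min)`
through Reznick's interpolation basis, §2.2) and the PTAS statement Theorem 1.7; Nesterov's
square-free bound (1.6); §3 (stable-set examples); `p^{(0)}_max` as a named maximum (it enters only
through the bound `U`).
-/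

noncomputable section

open MvPolynomial Finset

open scoped BigOperators

namespace Literature.Algebra.Polynomial.PolyaSimplexRate

variable {𝕜 : Type*} [Field 𝕜] [LinearOrder 𝕜] [IsStrictOrderedRing 𝕜]
variable {ι : Type*} [Fintype ι]

/-! ### §1 The weight `w_r(d)` ((1.12)–(1.13)) -/

variable (𝕜) in
/-- **The Pólya weight** `w_r(d) := (r+d)!/(r!(r+d)^d) = (1)^d_{1/(r+d)}`.
[cite: DeklerkLaurentParrilo2006, §1.3 eq. (1.12)] -/
def polyaWeight (r d : ℕ) : 𝕜 := ((r + d).descFactorial d : 𝕜) / ((r + d : ℕ) : 𝕜) ^ d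

/-- `w_r(d) > 0`. [cite: DeklerkLaurentParrilo2006, §1.3 eq. (1.13)] -/
theorem polyaWeight_pos (r d : ℕ) : 0 < polyaWeight 𝕜 r d := by
  unfold polyaWeight
  have h1 : 0 < (r + d).descFactorial d :=
    Nat.pos_of_ne_zero (by rw [Ne, Nat.descFactorial_eq_zero_iff_lt]; omega)
  rcases Nat.eq_zero_or_pos d with rfl | hd
  · simp
  · exact div_pos (by exact_mod_cast h1) (pow_pos (by exact_mod_cast (show 0 < r + d by omega)) _)

/-- `w_r(d) ≤ 1`. [cite: DeklerkLaurentParrilo2006, §1.3 eq. (1.13)] -/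
theorem polyaWeight_le_one (r d : ℕ) : polyaWeight 𝕜 r d ≤ 1 := by
  unfold polyaWeight
  refine div_le_one_of_le₀ ?_ (pow_nonneg (Nat.cast_nonneg _) _)
  exact_mod_cast Nat.descFactorial_le_pow (r + d) d

/-- **(1.12)** `w_r(d) = Π_{i=0}^{d−1} (1 − i/(r+d))` (the factor `i = 0` is `1`).
[cite: DeklerkLaurentParrilo2006, §1.3 eq. (1.12)] -/
theorem polyaWeight_eq_prod (r d : ℕ) (hM : 0 < r + d) :
    polyaWeight 𝕜 r d = ∏ i ∈ Finset.range d, (1 - (i : 𝕜) / ((r + d : ℕ) : 𝕜)) := by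
  unfold polyaWeight
  have hMne : ((r + d : ℕ) : 𝕜) ≠ 0 := by exact_mod_cast hM.ne'
  rw [Nat.descFactorial_eq_prod_range, Nat.cast_prod, ← Finset.card_range d, ← Finset.prod_const,
    Finset.card_range, ← Finset.prod_div_distrib]
  refine Finset.prod_congr rfl fun i hi => ?_
  have hi' : i ≤ r + d := by have := Finset.mem_range.1 hi; omega
  rw [Nat.cast_sub hi', sub_div, div_self hMne]

/-- The elementary bound `M^(d+1) ≤ M(M−1)⋯(M−d) + d(d+1)/2 · M^d` comparing a power with the falling
factorial of the same length (as in `PolyaPositivstellensatz.lean`, where it is private). [folklore] -/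
private theorem pow_succ_le_descFactorial_add_choose_mul_pow (M : ℕ) :
    ∀ d : ℕ, M ^ (d + 1) ≤ M.descFactorial (d + 1) + (d + 1).choose 2 * M ^ d
  | 0 => by simp
  | d + 1 => by
    have ih := pow_succ_le_descFactorial_add_choose_mul_pow M d
    rw [Nat.choose_succ_succ (d + 1) 1, Nat.choose_one_right]
    rcases Nat.lt_or_ge M (d + 2) with hM | hM
    · rw [Nat.descFactorial_eq_zero_iff_lt.mpr hM, zero_add, pow_succ, add_mul]
      calc M ^ (d + 1) * M ≤ M ^ (d + 1) * (d + 1) := Nat.mul_le_mul_left _ (by omega)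
        _ = (d + 1) * M ^ (d + 1) := by ring
        _ ≤ (d + 1) * M ^ (d + 1) + (d + 1).choose 2 * M ^ (d + 1) := Nat.le_add_right _ _
    · set D := M.descFactorial (d + 1) with hD
      have hdesc : D ≤ M ^ (d + 1) := Nat.descFactorial_le_pow _ _
      have hMD : M * D = (M - (d + 1)) * D + (d + 1) * D := by
        rw [← add_mul, Nat.sub_add_cancel (by omega)]
      rw [Nat.descFactorial_succ, ← hD]
      calc M ^ (d + 1 + 1) = M * M ^ (d + 1) := by ring
        _ ≤ M * (D + (d + 1).choose 2 * M ^ d) := Nat.mul_le_mul_left M ih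
        _ = (M - (d + 1)) * D + (d + 1) * D + (d + 1).choose 2 * M ^ (d + 1) := by
            rw [mul_add, hMD]; ring
        _ ≤ (M - (d + 1)) * D + (d + 1) * M ^ (d + 1) + (d + 1).choose 2 * M ^ (d + 1) := by
            gcongr
        _ = (M - (d + 1)) * D + ((d + 1) + (d + 1).choose 2) * M ^ (d + 1) := by ring

/-- `(r+d)^d − (r+d)!/r! ≤ C(d,2) (r+d)^{d−1}`, the integer form of (1.13). [folklore] -/
private theorem pow_sub_descFactorial_le (M d : ℕ) (hd : 0 < d) :
    ((M : ℕ) : 𝕜) ^ d - (M.descFactorial d : 𝕜) ≤ (d.choose 2 : 𝕜) * (M : 𝕜) ^ (d - 1) := by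
  have hd1 : d - 1 + 1 = d := Nat.sub_add_cancel hd
  have h := pow_succ_le_descFactorial_add_choose_mul_pow M (d - 1)
  rw [hd1] at h
  have h' : (M : 𝕜) ^ d ≤ (M.descFactorial d : 𝕜) + (d.choose 2 : 𝕜) * (M : 𝕜) ^ (d - 1) := by
    exact_mod_cast h
  linarith

/-- **(1.13)** `1 − C(d,2)/(r+d) ≤ w_r(d)`. [cite: DeklerkLaurentParrilo2006, §1.3 eq. (1.13)] -/
theorem one_sub_choose_div_le_polyaWeight (r d : ℕ) :
    1 - (d.choose 2 : 𝕜) / ((r + d : ℕ) : 𝕜) ≤ polyaWeight 𝕜 r d := by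
  unfold polyaWeight
  rcases Nat.eq_zero_or_pos d with rfl | hd
  · simp
  · set M := r + d with hM
    have hMpos : (0 : 𝕜) < (M : 𝕜) := by exact_mod_cast (show 0 < M by omega)
    have hd1 : d - 1 + 1 = d := Nat.sub_add_cancel hd
    have hMpow : (M : 𝕜) ^ d = (M : 𝕜) * (M : 𝕜) ^ (d - 1) := by rw [← pow_succ', hd1]
    have h := pow_sub_descFactorial_le (𝕜 := 𝕜) M d hd
    rw [le_div_iff₀ (pow_pos hMpos d), sub_mul, one_mul, div_mul_eq_mul_div, hMpow, ← mul_assoc,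
      mul_comm ((d.choose 2 : 𝕜) * (M : 𝕜)), ← mul_assoc, mul_div_assoc,
      div_self hMpos.ne', mul_one]
    rw [hMpow] at h
    linarith

/-! ### §2 The level-`r` Pólya LP, weak duality, and the grid criterion (2.3) -/

/-- **The level-`r` Pólya linear program.**  `PolyaFeasible r p d λ`: the polynomial
`(Σᵢ xᵢ)^r (p − λ (Σᵢ xᵢ)^d)` has nonnegative coefficients; for a form `p` of degree `d`,
`p^{(r)}_min = max {λ | PolyaFeasible r p d λ}`.
[cite: DeklerkLaurentParrilo2006, §1.3, display after (1.9) (definition of p^{(r)}_min)] -/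
def PolyaFeasible (r : ℕ) (p : MvPolynomial ι 𝕜) (d : ℕ) (lam : 𝕜) : Prop :=
  ∀ β, 0 ≤ coeff β ((∑ i, X i : MvPolynomial ι 𝕜) ^ r * (p - C lam * (∑ i, X i) ^ d))

/-- **The grid functional** `D_β(p) := Σ_α p_α Πᵢ βᵢ(βᵢ − 1)⋯(βᵢ − αᵢ + 1)` — for `|β| = r + d` this is
`(β!/r!) A_β`, `A_β` the coefficient of `x^β` in `(Σ xᵢ)^r p`, and `(r+d)^d Σ_α p_α Π (xᵢ)^{αᵢ}_t`
at the grid point `x = β/(r+d)`, `t = 1/(r+d)`.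
[cite: DeklerkLaurentParrilo2006, §2.1, displays before (2.3)] -/
def fallingEval (β : ι →₀ ℕ) (p : MvPolynomial ι 𝕜) : 𝕜 :=
  ∑ α ∈ p.support, coeff α p * ∏ i, ((β i).descFactorial (α i) : 𝕜)

variable (𝕜) in
/-- The grid point `x := β/k` of `Δ(k) = {x ∈ Δ | k x ∈ ℤⁿ}`.
[cite: DeklerkLaurentParrilo2006, §1.2 eq. (1.2); §2.1 («the point x := β/(r+d) belongs to Δ(r+d)»)] -/
def gridPoint (k : ℕ) (β : ι →₀ ℕ) : ι → 𝕜 := fun i => ((β i : ℕ) : 𝕜) / (k : 𝕜)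

/-- `β/|β| ∈ Δ`. [cite: DeklerkLaurentParrilo2006, §2.1 («the point x := β/(r+d) belongs to Δ(r+d)»)] -/
theorem gridPoint_mem_stdSimplex {k : ℕ} (hk : 0 < k) {β : ι →₀ ℕ} (hβ : β.degree = k) :
    gridPoint 𝕜 k β ∈ stdSimplex 𝕜 ι := by
  have hkpos : (0 : 𝕜) < (k : 𝕜) := Nat.cast_pos.mpr hk
  refine ⟨fun i => div_nonneg (Nat.cast_nonneg _) hkpos.le, ?_⟩
  simp only [gridPoint]
  rw [← Finset.sum_div, ← Nat.cast_sum, ← Finsupp.degree_eq_sum, hβ, div_self hkpos.ne']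

omit [LinearOrder 𝕜] [IsStrictOrderedRing 𝕜] in
/-- The coefficient of `x^β` in `(Σ xᵢ)^n` is the multinomial coefficient `n!/β!` for `|β| = n`.
[folklore] -/
private theorem coeff_sum_X_pow_of_degree_eq {n : ℕ} {β : ι →₀ ℕ} (hβ : β.degree = n) :
    coeff β ((∑ i, X i : MvPolynomial ι 𝕜) ^ n) = (β.multinomial : 𝕜) := by
  rw [coeff_sum_X_pow_of_fintype, if_pos]
  rw [Finsupp.degree_apply] at hβ
  simpa [Finsupp.sum] using hβ

omit [LinearOrder 𝕜] [IsStrictOrderedRing 𝕜] in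
/-- `Σ xᵢ` is a linear form. [folklore] -/
private theorem isHomogeneous_sum_X : (∑ i, X i : MvPolynomial ι 𝕜).IsHomogeneous 1 :=
  IsHomogeneous.sum _ _ _ fun i _ => isHomogeneous_X 𝕜 i

omit [LinearOrder 𝕜] [IsStrictOrderedRing 𝕜] in
/-- `(Σ xᵢ)^r (p − λ (Σ xᵢ)^d)` is a form of degree `r + d`. [folklore] -/
private theorem isHomogeneous_polyaPoly {d : ℕ} {p : MvPolynomial ι 𝕜} (hp : p.IsHomogeneous d)
    (lam : 𝕜) (r : ℕ) :
    ((∑ i, X i : MvPolynomial ι 𝕜) ^ r * (p - C lam * (∑ i, X i) ^ d)).IsHomogeneous (r + d) := by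
  have hS := isHomogeneous_sum_X (𝕜 := 𝕜) (ι := ι)
  have hq : (p - C lam * (∑ i, X i : MvPolynomial ι 𝕜) ^ d).IsHomogeneous d := by
    refine hp.sub ?_
    have := (isHomogeneous_C ι lam).mul (hS.pow d)
    simpa using this
  have := (hS.pow r).mul hq
  simpa using this

omit [LinearOrder 𝕜] [IsStrictOrderedRing 𝕜] in
/-- **The coefficient formula** for the LP polynomial: for `|β| = r + d`,
`β! · [x^β]((Σxᵢ)^r (p − λ(Σxᵢ)^d)) = r! · (D_β(p) − λ (r+d)!/r!)`.
[cite: DeklerkLaurentParrilo2006, §2.1, displays before (2.3) («A_β := Σ_{α ≤ β} r!/(β−α)! p_α»)] -/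
theorem prod_factorial_mul_coeff_polyaPoly {d : ℕ} {p : MvPolynomial ι 𝕜} (hp : p.IsHomogeneous d)
    (lam : 𝕜) (r : ℕ) (β : ι →₀ ℕ) (hβ : β.degree = r + d) :
    (∏ i, ((β i).factorial : 𝕜)) *
        coeff β ((∑ i, X i : MvPolynomial ι 𝕜) ^ r * (p - C lam * (∑ i, X i) ^ d)) =
      (r.factorial : 𝕜) * (fallingEval β p - lam * ((r + d).descFactorial d : 𝕜)) := by
  classical
  set S : MvPolynomial ι 𝕜 := ∑ i, X i with hS
  have h1 := prod_factorial_mul_coeff_sum_X_pow_mul p hp r β hβ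
  rw [← hS] at h1
  have h2 : coeff β (S ^ r * (C lam * S ^ d)) = lam * (β.multinomial : 𝕜) := by
    rw [mul_left_comm, ← pow_add, coeff_C_mul, hS, coeff_sum_X_pow_of_degree_eq hβ]
  have key : (∏ i, (β i).factorial) * β.multinomial = r.factorial * (r + d).descFactorial d := by
    rw [Finsupp.multinomial_eq_of_support_subset (Finset.subset_univ _), Nat.multinomial_spec,
      ← Finsupp.degree_eq_sum, hβ]
    have h := Nat.factorial_mul_descFactorial (Nat.le_add_left d r)
    rw [Nat.add_sub_cancel] at h
    exact h.symm
  have keyR := congrArg (Nat.cast : ℕ → 𝕜) key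
  push_cast at keyR
  rw [mul_sub, coeff_sub, mul_sub, h1, h2, ← mul_assoc, mul_comm (∏ i, ((β i).factorial : 𝕜)) lam,
    mul_assoc, keyR]
  unfold fallingEval
  ring

/-- **(2.3), the grid criterion**: for a form `p` of degree `d`, `λ` is feasible at level `r` iff
`λ (r+d)!/r! ≤ D_β(p)` for every `β` with `|β| = r + d` — i.e. `p^{(r)}_min = min_{|β| = r+d}
(r!/(r+d)!) D_β(p) = min_{x ∈ Δ(r+d)} (1/w_r(d)) Σ_α p_α Π (xᵢ)^{αᵢ}_{1/(r+d)}`.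
[cite: DeklerkLaurentParrilo2006, §2.1 eq. (2.3)] -/
theorem polyaFeasible_iff {r d : ℕ} {p : MvPolynomial ι 𝕜} (hp : p.IsHomogeneous d) {lam : 𝕜} :
    PolyaFeasible r p d lam ↔
      ∀ β : ι →₀ ℕ, β.degree = r + d → lam * ((r + d).descFactorial d : 𝕜) ≤ fallingEval β p := by
  have hprod : ∀ β : ι →₀ ℕ, (0 : 𝕜) < ∏ i, ((β i).factorial : 𝕜) := fun β =>
    Finset.prod_pos fun i _ => Nat.cast_pos.mpr (Nat.factorial_pos _)
  have hrfac : (0 : 𝕜) < (r.factorial : 𝕜) := Nat.cast_pos.mpr (Nat.factorial_pos _)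
  constructor
  · intro h β hβ
    have h1 := prod_factorial_mul_coeff_polyaPoly hp lam r β hβ
    have h2 : 0 ≤ (r.factorial : 𝕜) * (fallingEval β p - lam * ((r + d).descFactorial d : 𝕜)) := by
      rw [← h1]; exact mul_nonneg (hprod β).le (h β)
    have h3 := (mul_nonneg_iff_of_pos_left hrfac).mp h2
    linarith
  · intro h β
    by_cases hβ : β.degree = r + d
    · have h1 := prod_factorial_mul_coeff_polyaPoly hp lam r β hβ
      have h2 : 0 ≤ (∏ i, ((β i).factorial : 𝕜)) *
          coeff β ((∑ i, X i : MvPolynomial ι 𝕜) ^ r * (p - C lam * (∑ i, X i) ^ d)) := by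
        rw [h1]; exact mul_nonneg hrfac.le (by linarith [h β hβ])
      exact (mul_nonneg_iff_of_pos_left (hprod β)).mp h2
    · rw [(isHomogeneous_polyaPoly hp lam r).coeff_eq_zero hβ]

/-- **Weak duality** («`p^{(r)}_min ≤ p_min`»): a feasible `λ` is a lower bound of `p` on `Δ`, since
`(Σxᵢ)^r (p − λ(Σxᵢ)^d)` is `≥ 0` on the orthant and equals `p − λ` on `Δ`.
[cite: DeklerkLaurentParrilo2006, §1.3 («Obviously, p^{(0)}_min ≤ p^{(r)}_min ≤ p^{(r+1)}_min ≤ p_min»)] -/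
theorem PolyaFeasible.le_eval {r d : ℕ} {p : MvPolynomial ι 𝕜} {lam : 𝕜}
    (h : PolyaFeasible r p d lam) {x : ι → 𝕜} (hx : x ∈ stdSimplex 𝕜 ι) : lam ≤ eval x p := by
  have h1 := eval_nonneg_of_coeff_nonneg _ h (x := x) hx.1
  have hS : eval x (∑ i, X i : MvPolynomial ι 𝕜) = 1 := by simp [map_sum, hx.2]
  rw [map_mul, map_pow, map_sub, map_mul, map_pow, eval_C, hS, one_pow, one_pow, one_mul,
    mul_one] at h1
  linarith

/-- **Monotonicity in `r`** («`p^{(r)}_min ≤ p^{(r+1)}_min`»): multiplying a polynomial with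
nonnegative coefficients by `Σ xᵢ` keeps the coefficients nonnegative.
[cite: DeklerkLaurentParrilo2006, §1.3 («Obviously, p^{(0)}_min ≤ p^{(r)}_min ≤ p^{(r+1)}_min ≤ p_min»)] -/
theorem PolyaFeasible.succ {r d : ℕ} {p : MvPolynomial ι 𝕜} {lam : 𝕜} (h : PolyaFeasible r p d lam) :
    PolyaFeasible (r + 1) p d lam := by
  classical
  intro β
  rw [pow_succ', mul_assoc, Finset.sum_mul, coeff_sum]
  refine Finset.sum_nonneg fun i _ => ?_
  rw [coeff_X_mul']
  split_ifs
  · exact h _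
  · exact le_rfl

/-- Monotonicity in `r`, iterated. [cite: DeklerkLaurentParrilo2006, §1.3] -/
theorem PolyaFeasible.mono {r s d : ℕ} {p : MvPolynomial ι 𝕜} {lam : 𝕜} (h : PolyaFeasible r p d lam)
    (hrs : r ≤ s) : PolyaFeasible s p d lam := by
  induction s, hrs using Nat.le_induction with
  | base => exact h
  | succ s _ ih => exact ih.succ

/-- Monotonicity in `λ`: the feasible `λ` form a down-set (so `p^{(r)}_min` is a maximum over an
interval). [cite: DeklerkLaurentParrilo2006, §1.3 (definition of p^{(r)}_min as a maximum)] -/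
theorem PolyaFeasible.of_le {r d : ℕ} {p : MvPolynomial ι 𝕜} {lam μ : 𝕜} (h : PolyaFeasible r p d lam)
    (hμ : μ ≤ lam) : PolyaFeasible r p d μ := by
  intro β
  have key : (∑ i, X i : MvPolynomial ι 𝕜) ^ r * (p - C μ * (∑ i, X i) ^ d) =
      (∑ i, X i : MvPolynomial ι 𝕜) ^ r * (p - C lam * (∑ i, X i) ^ d) +
        C (lam - μ) * (∑ i, X i : MvPolynomial ι 𝕜) ^ (r + d) := by
    rw [map_sub, pow_add]; ring
  rw [key, coeff_add, coeff_C_mul]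
  refine add_nonneg (h β) (mul_nonneg (sub_nonneg.2 hμ) ?_)
  rw [coeff_sum_X_pow_of_fintype]
  split_ifs <;> simp

/-- The grid functional attains its minimum over the finite nonempty set `{β : |β| = k}` (`n ≥ 1`)
— the minimiser `β` of (2.3), `x_β ∈ Δ(k)`. [cite: DeklerkLaurentParrilo2006, §2.1 eq. (2.3)] -/
theorem exists_min_fallingEval [Nonempty ι] (p : MvPolynomial ι 𝕜) (k : ℕ) :
    ∃ β : ι →₀ ℕ, β.degree = k ∧ ∀ γ : ι →₀ ℕ, γ.degree = k → fallingEval β p ≤ fallingEval γ p := by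
  classical
  set S : MvPolynomial ι 𝕜 := ∑ i, X i with hS
  have hcpos : ∀ α : ι →₀ ℕ, (0 : 𝕜) < (α.multinomial : 𝕜) := fun α => by
    rw [Finsupp.multinomial_eq]; exact_mod_cast Nat.multinomial_pos _ _
  -- the finite nonempty set `T` of all `β` with `|β| = k`
  set T := (S ^ k).support with hT
  have hSk : (S ^ k).IsHomogeneous k := by
    rw [hS]; simpa using (isHomogeneous_sum_X (𝕜 := 𝕜) (ι := ι)).pow k
  have hTdeg : ∀ β ∈ T, β.degree = k := by
    intro β hβT
    by_contra hne
    exact (mem_support_iff.mp hβT) (hSk.coeff_eq_zero hne)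
  have hdegT : ∀ β : ι →₀ ℕ, β.degree = k → β ∈ T := by
    intro β hβ
    rw [hT, mem_support_iff, hS, coeff_sum_X_pow_of_degree_eq hβ]
    exact (hcpos β).ne'
  obtain ⟨i₀⟩ := ‹Nonempty ι›
  have hTne : T.Nonempty := ⟨Finsupp.single i₀ k, hdegT _ (Finsupp.degree_single _ _)⟩
  obtain ⟨β, hβT, hmin⟩ := Finset.exists_min_image T (fun γ => fallingEval γ p) hTne
  exact ⟨β, hTdeg β hβT, fun γ hγ => hmin γ (hdegT γ hγ)⟩

/-- **(1.10)**: at level `0`, `λ` is feasible iff `λ · d!/α! ≤ p_α` for all `|α| = d`, i.e.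
`p^{(0)}_min = min_α p_α α!/d!`. [cite: DeklerkLaurentParrilo2006, §1.3 eq. (1.10)] -/
theorem polyaFeasible_zero_iff {d : ℕ} {p : MvPolynomial ι 𝕜} (hp : p.IsHomogeneous d) {lam : 𝕜} :
    PolyaFeasible 0 p d lam ↔
      ∀ α : ι →₀ ℕ, α.degree = d → lam * (α.multinomial : 𝕜) ≤ coeff α p := by
  classical
  rw [polyaFeasible_iff hp]
  simp only [zero_add]
  -- at level `0`, `D_β(p) = p_β · β!`
  have hD : ∀ β : ι →₀ ℕ, β.degree = d →
      fallingEval β p = coeff β p * ∏ i, ((β i).factorial : 𝕜) := by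
    intro β hβ
    unfold fallingEval
    rw [Finset.sum_eq_single β]
    · exact congrArg _ (Finset.prod_congr rfl fun i _ => by rw [Nat.descFactorial_self])
    · intro α hα hne
      have hdegα : α.degree = d := by
        rw [Finsupp.degree_apply]; exact (hp.degree_eq_sum_deg_support hα).symm
      -- `α ≠ β` of the same degree: some `α i > β i`
      obtain ⟨i, hi⟩ : ∃ i, β i < α i := by
        by_contra hcon
        push Not at hcon
        apply hne
        have hsum : ∑ i, α i = ∑ i, β i := by
          rw [← Finsupp.degree_eq_sum, ← Finsupp.degree_eq_sum, hdegα, hβ]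
        exact Finsupp.ext fun i =>
          (Finset.sum_eq_sum_iff_of_le fun j _ => hcon j).1 hsum i (Finset.mem_univ i)
      rw [Finset.prod_eq_zero (Finset.mem_univ i)
        (by rw [Nat.descFactorial_eq_zero_iff_lt.mpr hi, Nat.cast_zero]), mul_zero]
    · intro hβ'
      rw [notMem_support_iff.1 hβ', zero_mul]
  -- `d! = (d!/β!) · β!`
  have hkey : ∀ β : ι →₀ ℕ, β.degree = d →
      (d.descFactorial d : 𝕜) = (β.multinomial : 𝕜) * ∏ i, ((β i).factorial : 𝕜) := by
    intro β hβ
    rw [Nat.descFactorial_self]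
    have h := Nat.multinomial_spec (Finset.univ : Finset ι) β
    rw [← Finsupp.degree_eq_sum, hβ,
      ← Finsupp.multinomial_eq_of_support_subset (Finset.subset_univ _)] at h
    rw [← h]
    push_cast
    ring
  refine forall_congr' fun β => forall_congr' fun hβ => ?_
  have hprod : (0 : 𝕜) < ∏ i, ((β i).factorial : 𝕜) :=
    Finset.prod_pos fun i _ => Nat.cast_pos.mpr (Nat.factorial_pos _)
  rw [hD β hβ, hkey β hβ, ← mul_assoc]
  exact ⟨fun h => le_of_mul_le_mul_right h hprod, fun h => mul_le_mul_of_nonneg_right h hprod.le⟩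

/-! ### §3 The estimate (2.13), Theorem 2.1 and Theorem 1.1 -/

omit [LinearOrder 𝕜] [IsStrictOrderedRing 𝕜] in
/-- A form of degree `d` is homogeneous under scaling of the argument: `p(c • x) = c^d p(x)`.
[folklore] -/
private theorem eval_smul_of_isHomogeneous (p : MvPolynomial ι 𝕜) {d : ℕ} (hp : p.IsHomogeneous d)
    (c : 𝕜) (x : ι → 𝕜) : eval (c • x) p = c ^ d * eval x p := by
  rw [eval_eq', eval_eq', Finset.mul_sum]
  refine Finset.sum_congr rfl fun α hα => ?_
  have hdeg : ∑ i, α i = d := by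
    rw [← Finsupp.degree_eq_sum, Finsupp.degree_apply]
    exact (hp.degree_eq_sum_deg_support hα).symm
  simp_rw [Pi.smul_apply, smul_eq_mul, mul_pow, Finset.prod_mul_distrib,
    Finset.prod_pow_eq_pow_sum, hdeg]
  ring

/-- **The Vandermonde–Chu identity (2.2) at an integer point**: for `|β| = r + d`,
`Σ_{|α| = d} (d!/α!) Πᵢ βᵢ(βᵢ−1)⋯(βᵢ−αᵢ+1) = (r+d)(r+d−1)⋯(r+1)` (the coefficient formula
applied to the form `(Σ xᵢ)^d`; as in `PolyaPositivstellensatz.lean`, where it is private).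
[cite: DeklerkLaurentParrilo2006, §2.1 eq. (2.2)] -/
theorem sum_multinomial_mul_descFactorial_prod (d r : ℕ) (β : ι →₀ ℕ) (hβ : β.degree = r + d) :
    ∑ α ∈ ((∑ i, X i : MvPolynomial ι 𝕜) ^ d).support,
        coeff α ((∑ i, X i : MvPolynomial ι 𝕜) ^ d) * ∏ i, ((β i).descFactorial (α i) : 𝕜) =
      ((r + d).descFactorial d : 𝕜) := by
  classical
  set S : MvPolynomial ι 𝕜 := ∑ i, X i with hS
  have hSd : (S ^ d).IsHomogeneous d := by
    rw [hS]; simpa using (isHomogeneous_sum_X (𝕜 := 𝕜) (ι := ι)).pow d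
  have h1 := prod_factorial_mul_coeff_sum_X_pow_mul (S ^ d) hSd r β hβ
  rw [← hS] at h1
  have hcoeffβ : coeff β (S ^ r * S ^ d) = (β.multinomial : 𝕜) := by
    rw [← pow_add, hS, coeff_sum_X_pow_of_degree_eq hβ]
  have key : (∏ i, (β i).factorial) * β.multinomial = r.factorial * (r + d).descFactorial d := by
    rw [Finsupp.multinomial_eq_of_support_subset (Finset.subset_univ _), Nat.multinomial_spec,
      ← Finsupp.degree_eq_sum, hβ]
    have h := Nat.factorial_mul_descFactorial (Nat.le_add_left d r)
    rw [Nat.add_sub_cancel] at h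
    exact h.symm
  have keyR := congrArg (Nat.cast : ℕ → 𝕜) key
  push_cast at keyR
  rw [hcoeffβ, keyR] at h1
  exact (mul_left_cancel₀ (Nat.cast_ne_zero.mpr (Nat.factorial_ne_zero r)) h1).symm

/-- **(2.13) at a grid point, integer form.**  If `p_α ≤ U · d!/α!` for all `α` (`p^{(0)}_max ≤ U`),
then for `|β| = r + d`,
`D_β(p) ≥ (r+d)^d · p(β/(r+d)) − U · ((r+d)^d − (r+d)(r+d−1)⋯(r+1))`
— i.e. `π(x) = p(x) − Σ_α p_α Π(xᵢ)^{αᵢ}_t ≤ U (1 − w_r(d))` at `x = β/(r+d)` («as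
`x^α ≥ Π (xᵢ)^{αᵢ}_t` and `p_α ≤ p^{(0)}_max d!/α!` … the right-hand side is equal to
`p^{(0)}_max ((Σxᵢ)^d − (Σxᵢ)^d_t) = p^{(0)}_max (1 − w_r(d))`»).
[cite: DeklerkLaurentParrilo2006, §2.1 eq. (2.13) (proof of Theorem 2.1)] -/
theorem fallingEval_ge {d : ℕ} {p : MvPolynomial ι 𝕜} (hp : p.IsHomogeneous d) {U : 𝕜}
    (hU : ∀ α, coeff α p ≤ U * (α.multinomial : 𝕜)) {r : ℕ} (β : ι →₀ ℕ)
    (hβ : β.degree = r + d) :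
    ((r + d : ℕ) : 𝕜) ^ d * eval (gridPoint 𝕜 (r + d) β) p -
        U * (((r + d : ℕ) : 𝕜) ^ d - ((r + d).descFactorial d : 𝕜)) ≤ fallingEval β p := by
  classical
  have h3S := sum_multinomial_mul_descFactorial_prod (𝕜 := 𝕜) d r β hβ
  set S : MvPolynomial ι 𝕜 := ∑ i, X i with hS
  set M : ℕ := r + d with hM_def
  -- the grid point `β/M` and the integer point `β = M • (β/M)`
  set y : ι → 𝕜 := fun i => ((β i : ℕ) : 𝕜) with hy
  have hyx : y = (M : 𝕜) • gridPoint 𝕜 M β := by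
    funext i
    simp only [hy, gridPoint, Pi.smul_apply, smul_eq_mul]
    by_cases hM0 : (M : 𝕜) = 0
    · have hM0' : M = 0 := by exact_mod_cast hM0
      have hβ0 : β = 0 := (Finsupp.degree_eq_zero_iff β).1 (by rw [hβ, hM0'])
      simp [hβ0]
    · field_simp
  have hevaly : eval y p = (M : 𝕜) ^ d * eval (gridPoint 𝕜 M β) p := by
    rw [hyx]; exact eval_smul_of_isHomogeneous p hp _ _
  have hsumβ : ∑ i, ((β i : ℕ) : 𝕜) = (M : 𝕜) := by
    rw [← Nat.cast_sum, ← Finsupp.degree_eq_sum, hβ]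
  -- the index set `T` of all multi-indices of degree `d` and the multinomials `c(α)`
  have hcpos : ∀ α : ι →₀ ℕ, (0 : 𝕜) < (α.multinomial : 𝕜) := fun α => by
    rw [Finsupp.multinomial_eq]; exact_mod_cast Nat.multinomial_pos _ _
  set T := (S ^ d).support with hT
  have hcT : ∀ α ∈ T, coeff α (S ^ d) = (α.multinomial : 𝕜) := by
    intro α hα
    have h := mem_support_iff.mp hα
    rw [hS, coeff_sum_X_pow_of_fintype] at h ⊢
    split_ifs at h ⊢ with hd
    · rfl
    · exact (h (by simp)).elim
  have hsub : p.support ⊆ T := by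
    intro α hα
    have hdegα : α.degree = d := by
      rw [Finsupp.degree_apply]; exact (hp.degree_eq_sum_deg_support hα).symm
    rw [hT, mem_support_iff, hS, coeff_sum_X_pow_of_degree_eq hdegα]
    exact (hcpos α).ne'
  -- falling factorials `D α` and powers `P α` at the integer point `β`
  set D : (ι →₀ ℕ) → 𝕜 := fun α => ∏ i, ((β i).descFactorial (α i) : 𝕜) with hD
  set P : (ι →₀ ℕ) → 𝕜 := fun α => ∏ i, ((β i : ℕ) : 𝕜) ^ (α i) with hP
  have hDP : ∀ α, D α ≤ P α := fun α => by
    simp only [hD, hP]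
    have h : (∏ i, (β i).descFactorial (α i)) ≤ ∏ i, (β i) ^ (α i) :=
      Finset.prod_le_prod (fun i _ => Nat.zero_le _) fun i _ => Nat.descFactorial_le_pow _ _
    exact_mod_cast h
  have h1 : fallingEval β p = ∑ α ∈ T, coeff α p * D α := by
    unfold fallingEval
    exact Finset.sum_subset hsub fun α _ hα => by rw [notMem_support_iff.mp hα, zero_mul]
  have h2f : ∑ α ∈ T, coeff α p * P α = eval y p := by
    rw [eval_eq']
    exact (Finset.sum_subset hsub fun α _ hα => by rw [notMem_support_iff.mp hα, zero_mul]).symm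
  have h2S : ∑ α ∈ T, coeff α (S ^ d) * P α = (M : 𝕜) ^ d := by
    rw [hT, ← eval_eq', map_pow, hS, map_sum]
    simp only [eval_X]
    rw [hsumβ]
  replace h3S : ∑ α ∈ T, coeff α (S ^ d) * D α = (M.descFactorial d : 𝕜) := h3S
  have h4 : ∑ α ∈ T, coeff α p * (P α - D α) ≤ U * ((M : 𝕜) ^ d - (M.descFactorial d : 𝕜)) := by
    have hrhs : U * ((M : 𝕜) ^ d - (M.descFactorial d : 𝕜)) =
        ∑ α ∈ T, U * (α.multinomial : 𝕜) * (P α - D α) := by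
      rw [← h2S, ← h3S, ← Finset.sum_sub_distrib, Finset.mul_sum]
      refine Finset.sum_congr rfl fun α hα => ?_
      rw [hcT α hα]; ring
    rw [hrhs]
    exact Finset.sum_le_sum fun α _ =>
      mul_le_mul_of_nonneg_right (hU α) (sub_nonneg.mpr (hDP α))
  have hsplit : ∑ α ∈ T, coeff α p * D α =
      ∑ α ∈ T, coeff α p * P α - ∑ α ∈ T, coeff α p * (P α - D α) := by
    rw [← Finset.sum_sub_distrib]; exact Finset.sum_congr rfl fun α _ => by ring
  rw [h1, hsplit, h2f, hevaly]
  linarith [h4]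

/-- A lower bound of `p` on `Δ` bounds the value at every grid point `β/(r+d)`, `|β| = r + d` (for
`r + d = 0` the form is constant and `Δ ≠ ∅` is used). [folklore] -/
private theorem le_eval_gridPoint [Nonempty ι] {d : ℕ} {p : MvPolynomial ι 𝕜}
    (hp : p.IsHomogeneous d) {lam : 𝕜} (hlam : ∀ x ∈ stdSimplex 𝕜 ι, lam ≤ eval x p) {r : ℕ}
    {β : ι →₀ ℕ} (hβ : β.degree = r + d) : lam ≤ eval (gridPoint 𝕜 (r + d) β) p := by
  classical
  rcases Nat.eq_zero_or_pos (r + d) with hM0 | hMpos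
  · have hd0 : d = 0 := by omega
    have hpC : p = C (coeff 0 p) := by
      apply totalDegree_eq_zero_iff_eq_C.1
      have := hp.totalDegree_le; rw [hd0] at this; omega
    obtain ⟨i⟩ := ‹Nonempty ι›
    have h := hlam (Pi.single i 1) (single_mem_stdSimplex 𝕜 i)
    rw [hpC, eval_C] at h ⊢
    exact h
  · exact hlam _ (gridPoint_mem_stdSimplex hMpos hβ)

/-- The defect bound behind Theorem 1.1: `U ((r+d)^d − (r+d)!/r!) ≤ U·C(d,2)(r+d)^{d−1} ≤ λ (r+d)^d`
when `U ≥ 0` and `U·C(d,2) ≤ λ(r+d)`. [folklore] -/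
private theorem defect_le {d : ℕ} (hd : 0 < d) {U lam : 𝕜} (hU0 : 0 ≤ U) (M : ℕ)
    (hr : U * (d.choose 2 : 𝕜) ≤ lam * (M : 𝕜)) :
    U * (((M : ℕ) : 𝕜) ^ d - (M.descFactorial d : 𝕜)) ≤ lam * (M : 𝕜) ^ d := by
  have hd1 : d - 1 + 1 = d := Nat.sub_add_cancel hd
  have hMpow : (M : 𝕜) ^ d = (M : 𝕜) * (M : 𝕜) ^ (d - 1) := by rw [← pow_succ', hd1]
  have hpow : (0 : 𝕜) ≤ (M : 𝕜) ^ (d - 1) := pow_nonneg (Nat.cast_nonneg _) _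
  calc U * (((M : ℕ) : 𝕜) ^ d - (M.descFactorial d : 𝕜))
      ≤ U * ((d.choose 2 : 𝕜) * (M : 𝕜) ^ (d - 1)) :=
        mul_le_mul_of_nonneg_left (pow_sub_descFactorial_le M d hd) hU0
    _ = U * (d.choose 2 : 𝕜) * (M : 𝕜) ^ (d - 1) := by ring
    _ ≤ lam * (M : 𝕜) * (M : 𝕜) ^ (d - 1) := mul_le_mul_of_nonneg_right hr hpow
    _ = lam * (M : 𝕜) ^ d := by rw [hMpow, mul_assoc]

/-- Strict form of `defect_le`: `U·C(d,2) < λ(r+d)` and `r + d > 0`. [folklore] -/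
private theorem defect_lt {d : ℕ} (hd : 0 < d) {U lam : 𝕜} (hU0 : 0 ≤ U) (M : ℕ) (hM : 0 < M)
    (hr : U * (d.choose 2 : 𝕜) < lam * (M : 𝕜)) :
    U * (((M : ℕ) : 𝕜) ^ d - (M.descFactorial d : 𝕜)) < lam * (M : 𝕜) ^ d := by
  have hd1 : d - 1 + 1 = d := Nat.sub_add_cancel hd
  have hMpow : (M : 𝕜) ^ d = (M : 𝕜) * (M : 𝕜) ^ (d - 1) := by rw [← pow_succ', hd1]
  have hpow : (0 : 𝕜) < (M : 𝕜) ^ (d - 1) := pow_pos (Nat.cast_pos.mpr hM) _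
  calc U * (((M : ℕ) : 𝕜) ^ d - (M.descFactorial d : 𝕜))
      ≤ U * ((d.choose 2 : 𝕜) * (M : 𝕜) ^ (d - 1)) :=
        mul_le_mul_of_nonneg_left (pow_sub_descFactorial_le M d hd) hU0
    _ = U * (d.choose 2 : 𝕜) * (M : 𝕜) ^ (d - 1) := by ring
    _ < lam * (M : 𝕜) * (M : 𝕜) ^ (d - 1) := mul_lt_mul_of_pos_right hr hpow
    _ = lam * (M : 𝕜) ^ d := by rw [hMpow, mul_assoc]

/-- **Theorem 2.1, (2.11), certificate form (the `O(1/r)` rate of the Pólya LP bounds).**  Let `p`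
be a form of degree `d` in `n ≥ 1` variables with `p_α α!/d! ≤ U` for all `α` (e.g.
`U = p^{(0)}_max`) and `λ ≤ p` on `Δ` (e.g. `λ = p_min`).  Then for every `r ≥ 0` the number
`μ_r := λ/w_r(d) − U (1/w_r(d) − 1)` is feasible at level `r` — `(Σxᵢ)^r (p − μ_r (Σxᵢ)^d)` has
nonnegative coefficients — so `p^{(r)}_min ≥ μ_r`, i.e. `λ − p^{(r)}_min ≤ (U − λ)(1/w_r(d) − 1)`.
Proof as printed: (2.3), (2.7) and (2.13).
[cite: DeklerkLaurentParrilo2006, §2.1 Theorem 2.1 eq. (2.11)] -/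
theorem polyaFeasible_rate [Nonempty ι] {d : ℕ} {p : MvPolynomial ι 𝕜} (hp : p.IsHomogeneous d)
    {U lam : 𝕜} (hU : ∀ α, coeff α p ≤ U * (α.multinomial : 𝕜))
    (hlam : ∀ x ∈ stdSimplex 𝕜 ι, lam ≤ eval x p) (r : ℕ) :
    PolyaFeasible r p d (lam / polyaWeight 𝕜 r d - U * (1 / polyaWeight 𝕜 r d - 1)) := by
  classical
  rw [polyaFeasible_iff hp]
  intro β hβ
  set M := r + d with hM_def
  have hdesc : (0 : 𝕜) < (M.descFactorial d : 𝕜) := by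
    exact_mod_cast Nat.pos_of_ne_zero (by rw [Ne, Nat.descFactorial_eq_zero_iff_lt]; omega)
  have hMd : (0 : 𝕜) < (M : 𝕜) ^ d := by
    rcases Nat.eq_zero_or_pos d with hd | hd
    · rw [hd, pow_zero]; exact one_pos
    · exact pow_pos (by exact_mod_cast (show 0 < M by omega)) _
  have hlamβ : lam ≤ eval (gridPoint 𝕜 M β) p := le_eval_gridPoint hp hlam hβ
  have hA := fallingEval_ge hp hU β hβ
  have h1 : lam * (M : 𝕜) ^ d ≤ (M : 𝕜) ^ d * eval (gridPoint 𝕜 M β) p := by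
    rw [mul_comm]; exact mul_le_mul_of_nonneg_left hlamβ hMd.le
  -- `μ_r · (r+d)!/r! = λ (r+d)^d − U ((r+d)^d − (r+d)!/r!)`
  have hdesc' : (M.descFactorial d : 𝕜) ≠ 0 := hdesc.ne'
  have hMd' : (M : 𝕜) ^ d ≠ 0 := hMd.ne'
  have hμ : (lam / polyaWeight 𝕜 r d - U * (1 / polyaWeight 𝕜 r d - 1)) *
        (M.descFactorial d : 𝕜) =
      lam * (M : 𝕜) ^ d - U * ((M : 𝕜) ^ d - (M.descFactorial d : 𝕜)) := by
    unfold polyaWeight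
    rw [← hM_def]
    field_simp
  rw [hμ]
  linarith

/-- **Theorem 2.1, (2.11)**: `∃ μ` feasible at level `r` with `λ − μ = (U − λ)(1/w_r(d) − 1)`.
[cite: DeklerkLaurentParrilo2006, §2.1 Theorem 2.1 eq. (2.11)] -/
theorem exists_polyaFeasible_sub_eq [Nonempty ι] {d : ℕ} {p : MvPolynomial ι 𝕜}
    (hp : p.IsHomogeneous d) {U lam : 𝕜} (hU : ∀ α, coeff α p ≤ U * (α.multinomial : 𝕜))
    (hlam : ∀ x ∈ stdSimplex 𝕜 ι, lam ≤ eval x p) (r : ℕ) :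
    ∃ μ, PolyaFeasible r p d μ ∧ lam - μ = (U - lam) * (1 / polyaWeight 𝕜 r d - 1) :=
  ⟨_, polyaFeasible_rate hp hU hlam r, by ring⟩

/-- **Theorem 2.1 with (1.13): an explicit `O(1/(r+d))` certificate.**  Under the hypotheses of
`polyaFeasible_rate`, with `c := C(d,2)` and `r + d > c`, the level-`r` LP certifies the bound
`λ − (U − λ) · c/(r + d − c)` (since `1/w_r(d) − 1 ≤ c/(r+d−c)` by (1.13); requires `U ≥ λ`, which
holds as soon as `Δ ≠ ∅`, see `le_of_coeff_le_of_le_eval`).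
[cite: DeklerkLaurentParrilo2006, §1.3 eq. (1.13); §2.1 Theorem 2.1 eq. (2.11)] -/
theorem polyaFeasible_rate_explicit [Nonempty ι] {d : ℕ} {p : MvPolynomial ι 𝕜}
    (hp : p.IsHomogeneous d) {U lam : 𝕜} (hU : ∀ α, coeff α p ≤ U * (α.multinomial : 𝕜))
    (hlam : ∀ x ∈ stdSimplex 𝕜 ι, lam ≤ eval x p) (hUlam : lam ≤ U) {r : ℕ}
    (hr : (d.choose 2 : 𝕜) < ((r + d : ℕ) : 𝕜)) :
    PolyaFeasible r p d
      (lam - (U - lam) * ((d.choose 2 : 𝕜) / (((r + d : ℕ) : 𝕜) - (d.choose 2 : 𝕜)))) := by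
  refine (polyaFeasible_rate hp hU hlam r).of_le ?_
  set w := polyaWeight 𝕜 r d with hw_def
  set c : 𝕜 := (d.choose 2 : 𝕜) with hc
  set M : 𝕜 := ((r + d : ℕ) : 𝕜) with hM
  have hw0 : 0 < w := polyaWeight_pos r d
  have hw1 : w ≤ 1 := polyaWeight_le_one r d
  have hwlow : 1 - c / M ≤ w := one_sub_choose_div_le_polyaWeight r d
  have hMc : 0 < M - c := sub_pos.2 hr
  have hM0 : 0 < M := lt_of_le_of_lt (by rw [hc]; exact Nat.cast_nonneg _) hr
  -- `1/w − 1 ≤ c/(M − c)`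
  have hinv : 1 / w - 1 ≤ c / (M - c) := by
    rw [div_sub_one hw0.ne', div_le_div_iff₀ hw0 hMc]
    have h1 : (M - c) / M ≤ w := by rwa [sub_div, div_self hM0.ne']
    have h2 : M - c ≤ w * M := by rwa [div_le_iff₀ hM0] at h1
    nlinarith
  have key : lam / w - U * (1 / w - 1) = lam - (U - lam) * (1 / w - 1) := by
    field_simp
    ring
  rw [key]
  have := mul_le_mul_of_nonneg_left hinv (sub_nonneg.2 hUlam)
  linarith

/-- `λ ≤ U` under the hypotheses of Theorem 2.1 as soon as there is a variable (`p_min ≤ p_max ≤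
p^{(0)}_max`, the `max` analogue of «`p^{(0)}_min ≤ p^{(r)}_min ≤ p_min`»): at the vertex `eᵢ ∈ Δ`,
`λ ≤ p(eᵢ) = p_{d eᵢ} ≤ U`.
[cite: DeklerkLaurentParrilo2006, §1.3 eq. (1.8), (1.10) and the display after (1.10)] -/
theorem le_of_coeff_le_of_le_eval [Nonempty ι] {d : ℕ} {p : MvPolynomial ι 𝕜}
    (hp : p.IsHomogeneous d) {U lam : 𝕜} (hU : ∀ α, coeff α p ≤ U * (α.multinomial : 𝕜))
    (hlam : ∀ x ∈ stdSimplex 𝕜 ι, lam ≤ eval x p) : lam ≤ U := by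
  classical
  obtain ⟨i⟩ := ‹Nonempty ι›
  -- the level-0 criterion at `β = d • eᵢ`: `D_β(p) = p_β β! ≥ …`; simpler: use `fallingEval_ge` with
  -- `r = 0` and the grid point `eᵢ`
  have hβ : (Finsupp.single i d).degree = 0 + d := by rw [zero_add, Finsupp.degree_single]
  have hA := fallingEval_ge hp hU (r := 0) (Finsupp.single i d) hβ
  have hlamβ := le_eval_gridPoint hp hlam hβ
  -- `D_{d eᵢ}(p) = p_{d eᵢ} · d!` and `p_{d eᵢ} ≤ U`
  have hD : fallingEval (Finsupp.single i d) p ≤ U * ((0 + d).descFactorial d : 𝕜) := by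
    unfold fallingEval
    have hsingle : ∀ α ∈ p.support, α ≠ Finsupp.single i d →
        coeff α p * ∏ j, (((Finsupp.single i d) j).descFactorial (α j) : 𝕜) = 0 := by
      intro α hα hne
      have hdegα : α.degree = d := by
        rw [Finsupp.degree_apply]; exact (hp.degree_eq_sum_deg_support hα).symm
      obtain ⟨j, hj⟩ : ∃ j, (Finsupp.single i d) j < α j := by
        by_contra hcon
        push Not at hcon
        apply hne
        have hsum : ∑ j, α j = ∑ j, (Finsupp.single i d) j := by
          rw [← Finsupp.degree_eq_sum, ← Finsupp.degree_eq_sum, hdegα, Finsupp.degree_single]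
        exact Finsupp.ext fun j =>
          (Finset.sum_eq_sum_iff_of_le fun k _ => hcon k).1 hsum j (Finset.mem_univ j)
      rw [Finset.prod_eq_zero (Finset.mem_univ j)
        (by rw [Nat.descFactorial_eq_zero_iff_lt.mpr hj, Nat.cast_zero]), mul_zero]
    rw [Finset.sum_eq_single (Finsupp.single i d) hsingle
      (fun h => by rw [notMem_support_iff.1 h, zero_mul])]
    have hprod : ∏ j, (((Finsupp.single i d) j).descFactorial ((Finsupp.single i d) j) : 𝕜) =
        (d.factorial : 𝕜) := by
      rw [Finset.prod_eq_single i (fun j _ hj => by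
        rw [Finsupp.single_eq_of_ne hj, Nat.descFactorial_zero, Nat.cast_one])
        (fun h => (h (Finset.mem_univ i)).elim), Finsupp.single_eq_same, Nat.descFactorial_self]
    have hmult : ((Finsupp.single i d).multinomial : 𝕜) = 1 := by
      rw [Finsupp.multinomial_eq_of_support_subset (Finset.subset_univ _)]
      have h := Nat.multinomial_spec (Finset.univ : Finset ι) (Finsupp.single i d)
      rw [← Finsupp.degree_eq_sum, Finsupp.degree_single, Finset.prod_eq_single i
        (fun j _ hj => by rw [Finsupp.single_eq_of_ne hj, Nat.factorial_zero])
        (fun h => (h (Finset.mem_univ i)).elim), Finsupp.single_eq_same] at h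
      have h' : Nat.multinomial Finset.univ (Finsupp.single i d) = 1 :=
        (Nat.mul_left_cancel_iff (Nat.factorial_pos d)).1 (by rw [h, mul_one])
      rw [h']; simp
    rw [hprod, zero_add, Nat.descFactorial_self]
    have := hU (Finsupp.single i d)
    rw [hmult, mul_one] at this
    exact mul_le_mul_of_nonneg_right this (Nat.cast_nonneg _)
  -- combine: `d^d λ − U (d^d − d!) ≤ D ≤ U d!` ⇒ `λ d^d ≤ U d^d`
  have hMd : (0 : 𝕜) < ((0 + d : ℕ) : 𝕜) ^ d := by
    rcases Nat.eq_zero_or_pos d with hd | hd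
    · subst hd; simp
    · exact pow_pos (by exact_mod_cast (show 0 < 0 + d by omega)) _
  have h1 : lam * ((0 + d : ℕ) : 𝕜) ^ d ≤ ((0 + d : ℕ) : 𝕜) ^ d * eval (gridPoint 𝕜 (0 + d) (Finsupp.single i d)) p := by
    rw [mul_comm]; exact mul_le_mul_of_nonneg_left hlamβ hMd.le
  by_contra hlt
  push Not at hlt
  have : U * ((0 + d : ℕ) : 𝕜) ^ d < lam * ((0 + d : ℕ) : 𝕜) ^ d := mul_lt_mul_of_pos_right hlt hMd
  linarith

/-- **Theorem 2.1, (2.12): the grid upper bound.**  If `p_α α!/d! ≤ U` for all `α` and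
`r + d ≥ 1`, some point `x_β = β/(r+d)` of the rational grid `Δ(r+d)` satisfies
`p(x_β) ≤ w_r(d) p(x) + U (1 − w_r(d))` for every `x ∈ Δ`; with `x` a minimiser this is
`p_{Δ(r+d)} − p_min ≤ (U − p_min)(1 − w_r(d))`.  Proof as printed: `x_β` the minimiser in (2.3),
weak duality `p^{(r)}_min ≤ p_min`, and (2.13).
[cite: DeklerkLaurentParrilo2006, §2.1 Theorem 2.1 eq. (2.12), via (2.6), (2.8), (2.10)] -/
theorem exists_gridPoint_eval_le [Nonempty ι] {d : ℕ} {p : MvPolynomial ι 𝕜}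
    (hp : p.IsHomogeneous d) {U : 𝕜} (hU : ∀ α, coeff α p ≤ U * (α.multinomial : 𝕜)) {r : ℕ}
    (hM : 0 < r + d) :
    ∃ β : ι →₀ ℕ, β.degree = r + d ∧ gridPoint 𝕜 (r + d) β ∈ stdSimplex 𝕜 ι ∧
      ∀ x ∈ stdSimplex 𝕜 ι,
        eval (gridPoint 𝕜 (r + d) β) p ≤ polyaWeight 𝕜 r d * eval x p + U * (1 - polyaWeight 𝕜 r d) := by
  classical
  set M := r + d with hM_def
  obtain ⟨β, hβ, hmin⟩ := exists_min_fallingEval p M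
  refine ⟨β, hβ, gridPoint_mem_stdSimplex hM hβ, fun x hx => ?_⟩
  have hdesc : (0 : 𝕜) < (M.descFactorial d : 𝕜) := by
    exact_mod_cast Nat.pos_of_ne_zero (by rw [Ne, Nat.descFactorial_eq_zero_iff_lt]; omega)
  have hMd : (0 : 𝕜) < (M : 𝕜) ^ d := pow_pos (by exact_mod_cast hM) _
  -- `μ := D_β(p) · r!/(r+d)!` is feasible (it is `p^{(r)}_min`), hence `μ ≤ p(x)`
  have hfeas : PolyaFeasible r p d (fallingEval β p / (M.descFactorial d : 𝕜)) := by
    rw [polyaFeasible_iff hp]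
    intro γ hγ
    rw [div_mul_cancel₀ _ hdesc.ne']
    exact hmin γ hγ
  have hμx := hfeas.le_eval hx
  have hA := fallingEval_ge hp hU β hβ
  set w := polyaWeight 𝕜 r d with hw_def
  have hwD : w = (M.descFactorial d : 𝕜) / (M : 𝕜) ^ d := by rw [hw_def]; unfold polyaWeight; rw [← hM_def]
  have hdesc' : (M.descFactorial d : 𝕜) ≠ 0 := hdesc.ne'
  have hMd' : (M : 𝕜) ^ d ≠ 0 := hMd.ne'
  calc eval (gridPoint 𝕜 M β) p
      ≤ w * (fallingEval β p / (M.descFactorial d : 𝕜)) + U * (1 - w) := by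
        refine le_of_mul_le_mul_right ?_ hMd
        have key : (w * (fallingEval β p / (M.descFactorial d : 𝕜)) + U * (1 - w)) * (M : 𝕜) ^ d =
            fallingEval β p + U * ((M : 𝕜) ^ d - (M.descFactorial d : 𝕜)) := by
          rw [hwD]; field_simp
        rw [key]
        linarith
    _ ≤ w * eval x p + U * (1 - w) := by
        have := mul_le_mul_of_nonneg_left hμx (polyaWeight_pos (𝕜 := 𝕜) r d).le
        linarith

/-- **Theorem 1.1 (Pólya's theorem with the one-sided constant `p^{(0)}_max`).**  Let `p` be a form
of degree `d` in `n ≥ 1` variables, `p_α α!/d! ≤ U` for all `α`, and `p ≥ λ > 0` on `Δ`.  If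
`U · C(d,2) ≤ λ (r + d)` — i.e. `r ≥ C(d,2) U/λ − d`, (1.9) — then `(Σᵢ xᵢ)^r p` has nonnegative
coefficients.  («Powers and Reznick proved that this holds for any `r ≥ C(d,2) L_p/p_min − d`. We
observe here that this holds … with `L_p` replaced by `p^{(0)}_max`.»)  Proof as printed, via
(2.13), (1.13) and (2.7).
[cite: DeklerkLaurentParrilo2006, §1.3 Theorem 1.1 (proof in §2.1)] -/
theorem coeff_sum_X_pow_mul_nonneg_of_le [Nonempty ι] {d : ℕ} {p : MvPolynomial ι 𝕜}
    (hp : p.IsHomogeneous d) {U lam : 𝕜} (hU : ∀ α, coeff α p ≤ U * (α.multinomial : 𝕜))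
    (hlam : ∀ x ∈ stdSimplex 𝕜 ι, lam ≤ eval x p) (hlam0 : 0 < lam) {r : ℕ}
    (hr : U * (d.choose 2 : 𝕜) ≤ lam * ((r + d : ℕ) : 𝕜)) (β : ι →₀ ℕ) :
    0 ≤ coeff β ((∑ i, X i : MvPolynomial ι 𝕜) ^ r * p) := by
  classical
  have hfeas : PolyaFeasible r p d 0 := by
    rw [polyaFeasible_iff hp]
    intro β hβ
    rw [zero_mul]
    have hA := fallingEval_ge hp hU β hβ
    have hlamβ := le_eval_gridPoint hp hlam hβ
    rcases Nat.eq_zero_or_pos d with hd0 | hd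
    · subst hd0
      simp only [pow_zero, one_mul, Nat.descFactorial_zero, Nat.cast_one, sub_self, mul_zero,
        sub_zero] at hA
      linarith
    · have hMpos : 0 < r + d := by omega
      have hMd : (0 : 𝕜) < ((r + d : ℕ) : 𝕜) ^ d := pow_pos (by exact_mod_cast hMpos) _
      have h1 : lam * ((r + d : ℕ) : 𝕜) ^ d ≤
          ((r + d : ℕ) : 𝕜) ^ d * eval (gridPoint 𝕜 (r + d) β) p := by
        rw [mul_comm]; exact mul_le_mul_of_nonneg_left hlamβ hMd.le
      have hpos : 0 < lam * ((r + d : ℕ) : 𝕜) ^ d := mul_pos hlam0 hMd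
      rcases le_or_gt U 0 with hU0 | hU0
      · have h2 : U * (((r + d : ℕ) : 𝕜) ^ d - ((r + d).descFactorial d : 𝕜)) ≤ 0 :=
          mul_nonpos_of_nonpos_of_nonneg hU0
            (sub_nonneg.2 (by exact_mod_cast Nat.descFactorial_le_pow (r + d) d))
        linarith
      · have h2 := defect_le hd hU0.le (r + d) hr
        linarith
  have h := hfeas β
  simpa using h

/-- **Theorem 1.1, strict form** (the Powers–Reznick conclusion with the one-sided constant): under
the hypotheses of `coeff_sum_X_pow_mul_nonneg_of_le` with the strict inequality
`U · C(d,2) < λ (r + d)`, every monomial of degree `r + d` has a strictly positive coefficient in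
`(Σᵢ xᵢ)^r p`.
[cite: DeklerkLaurentParrilo2006, §1.3 Theorem 1.1 and the remark after it (Powers–Reznick [18]);
§2.1] [cite: PowersReznick2001, Thm 1] -/
theorem coeff_sum_X_pow_mul_pos_of_lt [Nonempty ι] {d : ℕ} {p : MvPolynomial ι 𝕜}
    (hp : p.IsHomogeneous d) {U lam : 𝕜} (hU : ∀ α, coeff α p ≤ U * (α.multinomial : 𝕜))
    (hlam : ∀ x ∈ stdSimplex 𝕜 ι, lam ≤ eval x p) (hlam0 : 0 < lam) {r : ℕ}
    (hr : U * (d.choose 2 : 𝕜) < lam * ((r + d : ℕ) : 𝕜)) (β : ι →₀ ℕ)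
    (hβ : β.degree = r + d) :
    0 < coeff β ((∑ i, X i : MvPolynomial ι 𝕜) ^ r * p) := by
  classical
  have hA := fallingEval_ge hp hU β hβ
  have hlamβ := le_eval_gridPoint hp hlam hβ
  have hF : 0 < fallingEval β p := by
    rcases Nat.eq_zero_or_pos d with hd0 | hd
    · subst hd0
      simp only [pow_zero, one_mul, Nat.descFactorial_zero, Nat.cast_one, sub_self, mul_zero,
        sub_zero] at hA
      linarith
    · have hMpos : 0 < r + d := by omega
      have hMd : (0 : 𝕜) < ((r + d : ℕ) : 𝕜) ^ d := pow_pos (by exact_mod_cast hMpos) _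
      have h1 : lam * ((r + d : ℕ) : 𝕜) ^ d ≤
          ((r + d : ℕ) : 𝕜) ^ d * eval (gridPoint 𝕜 (r + d) β) p := by
        rw [mul_comm]; exact mul_le_mul_of_nonneg_left hlamβ hMd.le
      have hpos : 0 < lam * ((r + d : ℕ) : 𝕜) ^ d := mul_pos hlam0 hMd
      rcases le_or_gt U 0 with hU0 | hU0
      · have h2 : U * (((r + d : ℕ) : 𝕜) ^ d - ((r + d).descFactorial d : 𝕜)) ≤ 0 :=
          mul_nonpos_of_nonpos_of_nonneg hU0
            (sub_nonneg.2 (by exact_mod_cast Nat.descFactorial_le_pow (r + d) d))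
        linarith
      · have h2 := defect_lt hd hU0.le (r + d) hMpos hr
        linarith
  -- `β! · [x^β]((Σxᵢ)^r p) = r! · D_β(p) > 0`
  have h1 := prod_factorial_mul_coeff_sum_X_pow_mul p hp r β hβ
  have hprod : (0 : 𝕜) < ∏ i, ((β i).factorial : 𝕜) :=
    Finset.prod_pos fun i _ => Nat.cast_pos.mpr (Nat.factorial_pos _)
  have hrfac : (0 : 𝕜) < (r.factorial : 𝕜) := Nat.cast_pos.mpr (Nat.factorial_pos _)
  have h2 : 0 < (∏ i, ((β i).factorial : 𝕜)) * coeff β ((∑ i, X i : MvPolynomial ι 𝕜) ^ r * p) := by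
    rw [h1]; exact mul_pos hrfac hF
  exact (mul_pos_iff_of_pos_left hprod).mp h2

/-! ### §4 Over `ℝ`: `p_min`, `p^{(r)}_min`, and Theorems 2.1 and 1.1 in the printed form -/

section Real

variable {ι : Type*} [Fintype ι]

/-- `p_min := min_{x ∈ Δ} p(x)` ((1.1)), written as an infimum; it is attained
(`exists_eval_eq_simplexMin`). [cite: DeklerkLaurentParrilo2006, §1.1 eq. (1.1)] -/
def simplexMin (p : MvPolynomial ι ℝ) : ℝ := sInf ((fun x => eval x p) '' stdSimplex ℝ ι)

/-- `p_min` is attained on the (compact, nonempty) simplex. [cite: DeklerkLaurentParrilo2006, §1.1 eq. (1.1)] -/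
theorem exists_eval_eq_simplexMin [Nonempty ι] (p : MvPolynomial ι ℝ) :
    ∃ x ∈ stdSimplex ℝ ι, eval x p = simplexMin p ∧ ∀ y ∈ stdSimplex ℝ ι, eval x p ≤ eval y p := by
  classical
  have hne : (stdSimplex ℝ ι).Nonempty := ⟨_, single_mem_stdSimplex ℝ (Classical.arbitrary ι)⟩
  obtain ⟨x, hx, hmin⟩ :=
    (isCompact_stdSimplex ℝ ι).exists_isMinOn hne (MvPolynomial.continuous_eval p).continuousOn
  have hmin' : ∀ y ∈ stdSimplex ℝ ι, eval x p ≤ eval y p := fun y hy => isMinOn_iff.1 hmin y hy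
  have hleast : IsLeast ((fun x => eval x p) '' stdSimplex ℝ ι) (eval x p) :=
    ⟨⟨x, hx, rfl⟩, by rintro _ ⟨y, hy, rfl⟩; exact hmin' y hy⟩
  exact ⟨x, hx, (hleast.csInf_eq).symm, hmin'⟩

/-- `p_min ≤ p(x)` on `Δ`. [cite: DeklerkLaurentParrilo2006, §1.1 eq. (1.1)] -/
theorem simplexMin_le_eval [Nonempty ι] (p : MvPolynomial ι ℝ) {x : ι → ℝ}
    (hx : x ∈ stdSimplex ℝ ι) : simplexMin p ≤ eval x p := by
  obtain ⟨x₀, -, h0, hmin⟩ := exists_eval_eq_simplexMin p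
  rw [← h0]; exact hmin x hx

/-- **`p^{(r)}_min`** `:= max {λ | (Σxᵢ)^r (p(x) − λ(Σxᵢ)^d) has nonnegative coefficients}`, written
as a supremum; it is attained (`polyaFeasible_polyaBound`).
[cite: DeklerkLaurentParrilo2006, §1.3, display after (1.9)] -/
def polyaBound (r : ℕ) (p : MvPolynomial ι ℝ) (d : ℕ) : ℝ := sSup {lam | PolyaFeasible r p d lam}

/-- `p^{(r)}_min` is the greatest feasible `λ` (the maximum in its definition is attained, at
`λ = min_β (r!/(r+d)!) D_β(p)`, (2.3)). [cite: DeklerkLaurentParrilo2006, §2.1 eq. (2.3)] -/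
theorem isGreatest_polyaBound [Nonempty ι] {d : ℕ} {p : MvPolynomial ι ℝ} (hp : p.IsHomogeneous d)
    (r : ℕ) : IsGreatest {lam | PolyaFeasible r p d lam} (polyaBound r p d) := by
  obtain ⟨β, hβ, hmin⟩ := exists_min_fallingEval p (r + d)
  have hdesc : (0 : ℝ) < ((r + d).descFactorial d : ℝ) := by
    exact_mod_cast Nat.pos_of_ne_zero (by rw [Ne, Nat.descFactorial_eq_zero_iff_lt]; omega)
  have hgreat : IsGreatest {lam | PolyaFeasible r p d lam}
      (fallingEval β p / ((r + d).descFactorial d : ℝ)) := by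
    constructor
    · show PolyaFeasible r p d _
      rw [polyaFeasible_iff hp]
      intro γ hγ
      rw [div_mul_cancel₀ _ hdesc.ne']
      exact hmin γ hγ
    · intro lam hlam
      have h := (polyaFeasible_iff hp).1 hlam β hβ
      rw [le_div_iff₀ hdesc]
      exact h
  have heq : polyaBound r p d = fallingEval β p / ((r + d).descFactorial d : ℝ) := hgreat.csSup_eq
  rw [heq]
  exact hgreat

/-- The maximum defining `p^{(r)}_min` is attained: `p^{(r)}_min` itself is feasible.
[cite: DeklerkLaurentParrilo2006, §1.3, display after (1.9); §2.1 eq. (2.3)] -/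
theorem polyaFeasible_polyaBound [Nonempty ι] {d : ℕ} {p : MvPolynomial ι ℝ}
    (hp : p.IsHomogeneous d) (r : ℕ) : PolyaFeasible r p d (polyaBound r p d) :=
  (isGreatest_polyaBound hp r).1

/-- `λ` is feasible at level `r` iff `λ ≤ p^{(r)}_min`. [cite: DeklerkLaurentParrilo2006, §1.3] -/
theorem polyaFeasible_iff_le_polyaBound [Nonempty ι] {d : ℕ} {p : MvPolynomial ι ℝ}
    (hp : p.IsHomogeneous d) {r : ℕ} {lam : ℝ} :
    PolyaFeasible r p d lam ↔ lam ≤ polyaBound r p d :=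
  ⟨fun h => (isGreatest_polyaBound hp r).2 h, fun h => (polyaFeasible_polyaBound hp r).of_le h⟩

/-- **Weak duality** `p^{(r)}_min ≤ p_min`. [cite: DeklerkLaurentParrilo2006, §1.3
(«p^{(0)}_min ≤ p^{(r)}_min ≤ p^{(r+1)}_min ≤ p_min»)] -/
theorem polyaBound_le_simplexMin [Nonempty ι] {d : ℕ} {p : MvPolynomial ι ℝ}
    (hp : p.IsHomogeneous d) (r : ℕ) : polyaBound r p d ≤ simplexMin p := by
  obtain ⟨x₀, hx₀, h0, -⟩ := exists_eval_eq_simplexMin p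
  rw [← h0]
  exact (polyaFeasible_polyaBound hp r).le_eval hx₀

/-- **Monotonicity** `p^{(r)}_min ≤ p^{(r+1)}_min`. [cite: DeklerkLaurentParrilo2006, §1.3
(«p^{(0)}_min ≤ p^{(r)}_min ≤ p^{(r+1)}_min ≤ p_min»)] -/
theorem polyaBound_le_succ [Nonempty ι] {d : ℕ} {p : MvPolynomial ι ℝ} (hp : p.IsHomogeneous d)
    (r : ℕ) : polyaBound r p d ≤ polyaBound (r + 1) p d :=
  (polyaFeasible_iff_le_polyaBound hp).1 (polyaFeasible_polyaBound hp r).succ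

/-- **Theorem 2.1, (2.11), as printed.**  For a form `p` of degree `d` in `n ≥ 1` variables with
`p_α α!/d! ≤ U` for all `α` (i.e. `p^{(0)}_max ≤ U`) and every `r ≥ 0`:
`p_min − p^{(r)}_min ≤ (U − p_min)(1/w_r(d) − 1)`.
[cite: DeklerkLaurentParrilo2006, §2.1 Theorem 2.1 eq. (2.11)] -/
theorem simplexMin_sub_polyaBound_le [Nonempty ι] {d : ℕ} {p : MvPolynomial ι ℝ}
    (hp : p.IsHomogeneous d) {U : ℝ} (hU : ∀ α, coeff α p ≤ U * (α.multinomial : ℝ)) (r : ℕ) :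
    simplexMin p - polyaBound r p d ≤ (U - simplexMin p) * (1 / polyaWeight ℝ r d - 1) := by
  have hfeas := polyaFeasible_rate hp hU (fun _ hx => simplexMin_le_eval p hx) r
  have hle := (polyaFeasible_iff_le_polyaBound hp).1 hfeas
  have key : simplexMin p / polyaWeight ℝ r d - U * (1 / polyaWeight ℝ r d - 1) =
      simplexMin p - (U - simplexMin p) * (1 / polyaWeight ℝ r d - 1) := by ring
  rw [key] at hle
  linarith

/-- **Theorem 2.1, (2.12), as printed.**  For a form `p` of degree `d ≥ 1 − r` in `n ≥ 1`
variables with `p^{(0)}_max ≤ U`: `p_{Δ(r+d)} − p_min ≤ (U − p_min)(1 − w_r(d))` — some grid point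
`x_β ∈ Δ(r+d)` has `p(x_β) − p_min ≤ (U − p_min)(1 − w_r(d))`.
[cite: DeklerkLaurentParrilo2006, §2.1 Theorem 2.1 eq. (2.12)] -/
theorem exists_gridPoint_sub_simplexMin_le [Nonempty ι] {d : ℕ} {p : MvPolynomial ι ℝ}
    (hp : p.IsHomogeneous d) {U : ℝ} (hU : ∀ α, coeff α p ≤ U * (α.multinomial : ℝ)) {r : ℕ}
    (hM : 0 < r + d) :
    ∃ β : ι →₀ ℕ, β.degree = r + d ∧ gridPoint ℝ (r + d) β ∈ stdSimplex ℝ ι ∧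
      eval (gridPoint ℝ (r + d) β) p - simplexMin p ≤ (U - simplexMin p) * (1 - polyaWeight ℝ r d) := by
  obtain ⟨β, hβ, hmem, hle⟩ := exists_gridPoint_eval_le hp hU hM
  obtain ⟨x₀, hx₀, h0, -⟩ := exists_eval_eq_simplexMin p
  refine ⟨β, hβ, hmem, ?_⟩
  have := hle x₀ hx₀
  rw [h0] at this
  linarith

/-- **Theorem 1.1, as printed.**  «Let `p` be a form of degree `d` which is positive on the simplex,
i.e. `p_min > 0`. Then the polynomial `(Σᵢ xᵢ)^r p(x)` has nonnegative coefficients for all `r`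
satisfying `r ≥ C(d,2) p^{(0)}_max/p_min − d`» — here with any `U ≥ p^{(0)}_max`, the condition
written as `U·C(d,2) ≤ p_min (r + d)`.
[cite: DeklerkLaurentParrilo2006, §1.3 Theorem 1.1] -/
theorem coeff_sum_X_pow_mul_nonneg [Nonempty ι] {d : ℕ} {p : MvPolynomial ι ℝ}
    (hp : p.IsHomogeneous d) {U : ℝ} (hU : ∀ α, coeff α p ≤ U * (α.multinomial : ℝ))
    (hpos : 0 < simplexMin p) {r : ℕ} (hr : U * (d.choose 2 : ℝ) ≤ simplexMin p * ((r + d : ℕ) : ℝ))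
    (β : ι →₀ ℕ) : 0 ≤ coeff β ((∑ i, X i : MvPolynomial ι ℝ) ^ r * p) :=
  coeff_sum_X_pow_mul_nonneg_of_le hp hU (fun _ hx => simplexMin_le_eval p hx) hpos hr β

end Real

end Literature.Algebra.Polynomial.PolyaSimplexRate

end
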